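import Mathlib
import Summits.MatrixMultiplication.Statement
import Literature.Computability.AlgebraicComplexity.FlatteningBound
import Summits.MatrixMultiplication.MatrixMultiplication.Theorems.GraphEquationsSystems
import Summits.MatrixMultiplication.MatrixMultiplication.Theorems.GraphEquationsGenerators

/-!
# GraphEquations — the cut `S ⟺ V ∧ H` and its kernel (`GraphEquations`, 3/4)

Decomp-mm node `N5²³` «GraphEquations» (lens 5, generation 23/24; critic-cleared decomp-mm STATUS
l.1211/l.1216, writer DECISION l.1214).  Target VERBATIM: `_root_.MatrixMultiplication`
(`= (omega ℂ = 2)`, `MatrixMultiplication_iff`).  Model: `GraphEquationsSystems` (equation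
systems `EqSystem n` for the graph `W_n = {C = AB}`, `EqAdmissible β`, `EqAdmissibleRed β`).

**The cut.** `S ⟺ V ∧ H`, EXACT and UNCONDITIONAL (`summit_iff`; the necessities use BCS
Prop. (15.1), proved in the tree):
* `V = GraphEquationsQuadratic`: `∀ β > 2, EqAdmissible β` — the graph is cut out by equations of
  quadratic cost.  Tags: crux · NECESSARY (`nec_quadratic`: compute `AB` in `O(n^{2+ε})` and test
  `C − AB = 0`) · WEAKER-UNDECIDED (world `ω = 2.37` with the "multiplicity loophole": NON-REDUCED
  tests — cheaply computable members of high symbolic powers of `I(W_n)` — cutting out `W_n` at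
  quadratic cost; nothing in print excludes it, no typed lawful model either) · IDEA-NEEDED ·
  INSTRUMENTABLE at `n = 2, 3` (`LoopholeAtTwo`).
* `H = EquationsForceMultiplication`: `∀ β ≥ 2, EqAdmissible β → ω ≤ β` — equations for the graph
  are never polynomially cheaper than multiplication; the non-adaptive division-free form of a
  positive answer to BCS Problem 16.3.  Tags: crux · NECESSARY (kernel-trivial) · WEAKER-UNDECIDED
  (world `(ω, ω_eq) = (2.37, 2.37)`; open in print: BCS p.483, Künnemann 2018 p.3).
  Split beneath `H` (glue `forceMultiplication_of_split`): `H ⟸ H_red ∧ H_mult` with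
  - `H_red = ReducedEquationsForceMultiplication` (GENERICALLY REDUCED systems force fast
    multiplication) — support · NEC-trivial · THEOREM-CANDIDATE via the uniform cost–rank
    inequality `H_red♭ = ReducedSystemsCostRank` (`R(⟨n,n,n⟩) ≤ 2 · cost`: quadratic truncation
    of the program at a reduced point of the graph, Strassen 1973 / BCS Prop. (14.1), (14.8); glue
    `reducedForce_of_costRank`; pipeline in `GraphEquationsCostRank`) — ATTACKABLE NOW;
  - `H_mult = MultiplicityReduction` (a cheap system can be replaced by a cheap generically reduced
    one at sub-polynomial loss) — crux · NECESSARY (`nec_multiplicityReduction`) · IDEA-NEEDED: the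
    OPEN CORE of the axis.  Known (memo NODE-g23 §1.5): vanishing order `M` along `W_n` is removed
    at cost factor `O(M²)` by Taylor-mode differentiation in the `C`-direction, so the loophole
    needs `M ≥ n^{Ω(1)}`.
* Finite instruments (asides): `LoopholeAtTwo` (a correct system for `W_2` with ≤ 6 product gates;
  census I67: every correct system for `W_2` has ≥ 6 product gates, and `LoopholeAtTwo ⟺` a
  6-product configuration in normal form B exists — UNDECIDED) and `ReducedNeedsSeven`
  (theorem-candidate: truncation + `L(⟨2,2,2⟩) = 7`, BCS Thm. (17.12)).
* Caveat (critic = kill test K1): if `H` is ever proved, `V` becomes summit-strength and the node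
  must be re-cut.

Kernel content (no `sorry`): `closes : V → H → S`; `nec_*`; `summit_iff`, `summit_iff_split`;
the glue theorems `forceMultiplication_of_split`, `reducedForce_of_costRank(Cost)`.

Sources: [BurgisserClausenShokrollahi1997 Problem 16.3 p.483, Prop. (15.1) p.375–377, Prop. (14.1),
(14.8), Thm. (17.12) p.460, verification bounds p.318]; [Kunnemann2018 arXiv:1806.09189 p.3, 5, 19];
[Strassen1973 Vermeidung von Divisionen]; [Winograd1971 `L(⟨2,2,2⟩) = 7`].
-/

set_option linter.dupNamespace false

noncomputable section

open scoped BigOperators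

namespace Summit.MatrixMultiplication.MatrixMultiplication.Theorems.GraphEquations

open Literature.Computability.AlgebraicComplexity
open Literature.Computability.AlgebraicComplexity.ArithCircuit

/-! ## The pieces -/

/-- **Piece `V` (crux; NEC; WEAKER-UNDECIDED; IDEA-NEEDED; INSTRUMENTABLE n = 2, 3).** The graph of
matrix multiplication is cut out by equations of quadratic cost: `∀ β > 2, EqAdmissible β`.
(sources: BurgisserClausenShokrollahi1997, Problem 16.3) -/
def GraphEquationsQuadratic : Prop := ∀ β : ℝ, 2 < β → EqAdmissible β

/-- **Piece `H` (crux, parent of the split; NEC-trivial; WEAKER-UNDECIDED).** Equations for the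
graph force fast multiplication: `EqAdmissible β → ω ≤ β`.  The non-adaptive division-free form of
a positive answer to BCS Problem 16.3. (sources: BurgisserClausenShokrollahi1997, Problem 16.3) -/
def EquationsForceMultiplication : Prop := ∀ β : ℝ, 2 ≤ β → EqAdmissible β → omega ℂ ≤ β

/-- **`H_red` (support; NEC-trivial; theorem-candidate).** GENERICALLY REDUCED equation systems
force fast multiplication.  Follows from `ReducedSystemsCostRank` (`reducedForce_of_costRank`).
(sources: Strassen1973, quadratic truncation; BurgisserClausenShokrollahi1997, (14.8)/(15.1)) -/
def ReducedEquationsForceMultiplication : Prop :=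
  ∀ β : ℝ, 2 ≤ β → EqAdmissibleRed β → omega ℂ ≤ β

/-- **`H_mult` (crux — the open core; NEC; IDEA-NEEDED).** MULTIPLICITY REDUCTION: a correct
system of cost `O(n^β)` can be replaced by a correct, generically reduced one of cost `O(n^{β'})`
for every `β' > β`. (sources: BurgisserClausenShokrollahi1997, Problem 16.3; Kunnemann2018 arXiv:1806.09189) -/
def MultiplicityReduction : Prop :=
  ∀ β : ℝ, 2 ≤ β → EqAdmissible β → ∀ β' : ℝ, β < β' → EqAdmissibleRed β'

/-- **`H_red♭` (support; THEOREM-CANDIDATE, uniform in `n`, asymptotics-free).** A correct system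
reduced at a point of the graph has at least `R(⟨n,n,n⟩)/2` product gates: truncating the program
modulo `𝔪_x³` at a reduced point `x ∈ W_n` yields a bilinear computation of
`(id ⊗ id ⊗ J_C(x)) ⟨n,n,n⟩` with `J_C(x)` of rank `n²`, of length ≤ `2 · prodCount`.
(sources: Strassen1973; BurgisserClausenShokrollahi1997, Prop. (14.1), (14.8), §15.1) -/
def ReducedSystemsCostRank : Prop :=
  ∀ (n : ℕ) (E : EqSystem n), E.Correct → E.GenericallyReduced →
    tensorRank (matMulTensor ℂ n n n) ≤ 2 * E.prodCount

/-- **`H_red♭` in the COST version** (what the assembly actually needs; `prodCount ≤ cost`;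
the tree's nonscalar pipeline bounds by the number of gates). -/
def ReducedSystemsCostRankCost : Prop :=
  ∀ (n : ℕ) (E : EqSystem n), E.Correct → E.GenericallyReduced →
    tensorRank (matMulTensor ℂ n n n) ≤ 2 * E.cost

/-- **Instrument (aside; UNDECIDED, searchable).** A correct system for `W_2` with at most `6`
product gates — verification of `2 × 2` products strictly cheaper than multiplication
(`L(⟨2,2,2⟩) = 7`) in Ostrowski's measure; necessarily non-reduced (`ReducedNeedsSeven`).
Census I67 (decomp-mm v18): every correct system for `W_2` has `prodCount ≥ 6`, so this is the
exact threshold.  (sources: Winograd1971; BurgisserClausenShokrollahi1997, Thm. (17.12)) -/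
def LoopholeAtTwo : Prop := ∃ E : EqSystem 2, E.Correct ∧ E.prodCount ≤ 6

/-- **Rung (aside; theorem-candidate).** Generically reduced systems for `W_2` need `7` product
gates (`ReducedSystemsCostRank` at `n = 2` gives only `≥ 4`; the sharper `7` is truncation to a
FULL bilinear computation of `(id⊗id⊗Q)⟨2,2,2⟩ ≅ ⟨2,2,2⟩` plus `L(⟨2,2,2⟩) = 7`).
(sources: Winograd1971; BurgisserClausenShokrollahi1997, Thm. (17.12)) -/
def ReducedNeedsSeven : Prop :=
  ∀ E : EqSystem 2, E.Correct → E.GenericallyReduced → 7 ≤ E.prodCount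

/-! ## Kernel: the cut decides the summit -/

/-- **Deciding theorem.** `V → H → S` (density of `ℝ` and `2 ≤ ω`). -/
theorem closes (hV : GraphEquationsQuadratic) (hH : EquationsForceMultiplication) :
    _root_.MatrixMultiplication := by
  rw [MatrixMultiplication_iff]
  refine le_antisymm ?_ (omega_two_le ℂ)
  exact le_of_forall_gt_imp_ge_of_dense fun β hβ => hH β hβ.le (hV β hβ)

/-- `H` is NECESSARY (kernel-trivial). -/
theorem nec_forceMultiplication (hS : _root_.MatrixMultiplication) :
    EquationsForceMultiplication := by
  rw [MatrixMultiplication_iff] at hS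
  intro β hβ _
  rw [hS]; exact hβ

/-- `H_red` is NECESSARY (kernel-trivial). -/
theorem nec_reducedForce (hS : _root_.MatrixMultiplication) :
    ReducedEquationsForceMultiplication := by
  rw [MatrixMultiplication_iff] at hS
  intro β hβ _
  rw [hS]; exact hβ

/-- `V` is NECESSARY (unconditional, via the generator system and BCS Prop. (15.1)). -/
theorem nec_quadratic (hS : _root_.MatrixMultiplication) : GraphEquationsQuadratic := by
  rw [MatrixMultiplication_iff] at hS
  intro β hβ
  exact eqAdmissible_of_omega_lt (by rw [hS]; exact hβ)

/-- `H_mult` is NECESSARY (unconditional: under `ω = 2` the generator systems are cheap and reduced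
everywhere). -/
theorem nec_multiplicityReduction (hS : _root_.MatrixMultiplication) : MultiplicityReduction := by
  rw [MatrixMultiplication_iff] at hS
  intro β hβ _ β' hβ'
  exact eqAdmissibleRed_of_omega_lt (by rw [hS]; exact lt_of_le_of_lt hβ hβ')

/-- **Glue of the split** `H ⟸ H_red ∧ H_mult` (density of `ℝ`). -/
theorem forceMultiplication_of_split (hred : ReducedEquationsForceMultiplication)
    (hmult : MultiplicityReduction) : EquationsForceMultiplication := by
  intro β hβ hE
  refine le_of_forall_gt_imp_ge_of_dense fun β' hβ' => ?_
  exact hred β' (hβ.trans hβ'.le) (hmult β hβ hE β' hβ')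

/-- **Glue** `H_red ⟸ H_red♭ (cost version)`: a uniform rank bound per `n` gives the exponent
inequality (`R(⟨n,n,n⟩) ≤ 2 cost = O(n^β)` ⟹ `β` admissible ⟹ `ω ≤ β`). -/
theorem reducedForce_of_costRankCost (h : ReducedSystemsCostRankCost) :
    ReducedEquationsForceMultiplication := by
  intro β _ hE
  obtain ⟨c, hc⟩ := hE
  have hmem : β ∈ admissibleExponents ℂ := by
    change (fun n : ℕ => (tensorRank (matMulTensor ℂ n n n) : ℝ)) =O[Filter.atTop]
      fun n : ℕ => (n : ℝ) ^ β
    refine Asymptotics.IsBigO.of_bound (2 * |c|) ?_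
    filter_upwards [Filter.eventually_ge_atTop 1] with n hn
    obtain ⟨E, hE, hred, hcost⟩ := hc n hn
    have h1 := h n E hE hred
    rw [Real.norm_of_nonneg (Nat.cast_nonneg _),
      Real.norm_of_nonneg (Real.rpow_nonneg (Nat.cast_nonneg _) _)]
    have h3 : (tensorRank (matMulTensor ℂ n n n) : ℝ) ≤ 2 * (E.cost : ℝ) := by
      exact_mod_cast h1
    have h4 : c * (n : ℝ) ^ β ≤ |c| * (n : ℝ) ^ β := by
      gcongr; exact le_abs_self c
    nlinarith [h3, hcost, h4, Real.rpow_nonneg (Nat.cast_nonneg n) β]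
  exact csInf_le (admissibleExponents_bddBelow ℂ) hmem

/-- The product-count version implies the cost version (`prodCount ≤ cost`). -/
theorem costRankCost_of_costRank (h : ReducedSystemsCostRank) : ReducedSystemsCostRankCost :=
  fun n E hE hred => (h n E hE hred).trans (Nat.mul_le_mul_left 2 E.prodCount_le_cost)

/-- **Glue** `H_red ⟸ H_red♭`. -/
theorem reducedForce_of_costRank (h : ReducedSystemsCostRank) :
    ReducedEquationsForceMultiplication :=
  reducedForce_of_costRankCost (costRankCost_of_costRank h)

/-- The reduced branch assembled: `H_red♭ (cost) → H_mult → H`. -/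
theorem forceMultiplication_of_costRankCost (h : ReducedSystemsCostRankCost)
    (hmult : MultiplicityReduction) : EquationsForceMultiplication :=
  forceMultiplication_of_split (reducedForce_of_costRankCost h) hmult

/-! ## Exactness of the cut (unconditional) -/

/-- **Exactness of the cut**: `S ⟺ V ∧ H`. -/
theorem summit_iff :
    _root_.MatrixMultiplication ↔ (GraphEquationsQuadratic ∧ EquationsForceMultiplication) :=
  ⟨fun hS => ⟨nec_quadratic hS, nec_forceMultiplication hS⟩, fun h => closes h.1 h.2⟩

/-- **Exactness of the refined cut**: `S ⟺ V ∧ H_red ∧ H_mult`. -/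
theorem summit_iff_split :
    _root_.MatrixMultiplication ↔
      (GraphEquationsQuadratic ∧ ReducedEquationsForceMultiplication ∧ MultiplicityReduction) :=
  ⟨fun hS => ⟨nec_quadratic hS, nec_reducedForce hS, nec_multiplicityReduction hS⟩,
    fun h => closes h.1 (forceMultiplication_of_split h.2.1 h.2.2)⟩

/-- Under `H`, the summit is EQUIVALENT to `V` (the conjunct split read from `H`'s side). -/
theorem summit_iff_quadratic_of_force (hH : EquationsForceMultiplication) :
    _root_.MatrixMultiplication ↔ GraphEquationsQuadratic :=
  ⟨nec_quadratic, fun hV => closes hV hH⟩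

/-- Under `V`, the summit is EQUIVALENT to `H`. -/
theorem summit_iff_force_of_quadratic (hV : GraphEquationsQuadratic) :
    _root_.MatrixMultiplication ↔ EquationsForceMultiplication :=
  ⟨nec_forceMultiplication, fun hH => closes hV hH⟩

/-- Non-vacuity of `H`'s hypothesis in the proved regime: `EqAdmissible (5/2)` holds, so `H`
asserts something already at `β = 5/2` (namely `ω ≤ 5/2`, true) and is not vacuous. -/
theorem eqAdmissible_five_halves : EqAdmissible (5 / 2) :=
  eqAdmissibleRed_five_halves.eqAdmissible

end Summit.MatrixMultiplication.MatrixMultiplication.Theorems.GraphEquations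

end
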